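import Mathlib
import Summits.CriticalPhenomena.Ising3DConformalLimit.Theses.PrecisionLaplacian
import Summits.CriticalPhenomena.Ising3DConformalLimit.Theses.HyperoctahedralRP

/-!
# Sketch — crux-ideate round 1, ideator 1 (generation 2), crux `StableConeRPRigidity`
# (stmt-CriticalPhenomena-4800, route PrecisionLaplacian)

First lemmas of the three idea cards of this seat (signatures only, nothing below is proved except the
final reduction `stableConeRPRigidity_of_nineMirrorRigidityBelowFour`, which is kernel-checked):

* card `riesz-probe-xray-mellin` (lead, new in generation 2): `SchurRieszProbe`, `XRayFourLineRP`,
  `RadialXRaysGiveAxialSymmetry`, the packaged target `NineMirrorRigidityBelowFour` and the checked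
  transfer `NineMirrorRigidityBelowFour → StableConeRPRigidity`.
* card `entire-profile-null-growth` (engine; gen-1 card, audited and sharpened): `PolarisedHalfPlaneExtension`
  (the only analytic import, one mirror, one variable), `PlanarFourLineRigidity` (the d = 2 theorem the
  whole line runs on), `CoordinatePlaneIsotropy`, `NineSlabEntireProfiles`.
* card `levy-side-linearisation` (structure / falsification engine; gen-1 card, refreshed):
  `RPDescendsToLevyMeasure`.
-/

namespace Summit.CriticalPhenomena.Ising3DConformalLimit.Cruxes.StableConeRPRigidity.Sketch

open scoped BigOperators Topology Classical MeasureTheory Matrix InnerProductSpace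
open Filter Set Function MeasureTheory

/-- shorthand: `E3 = ℝ³`, `E2 = ℝ²` as Euclidean spaces -/
abbrev E3 := EuclideanSpace ℝ (Fin 3)
abbrev E2 := EuclideanSpace ℝ (Fin 2)

/-- Reflection positivity of a translation-invariant kernel `K` with respect to the mirror with
normal `n` (finite configurations strictly inside the open half-space `{x | ⟪x,n⟫ > 0}`), exactly
the clause of the crux. -/
def IsRP {ι : Type} [Fintype ι] (K : EuclideanSpace ℝ ι → ℝ) (n : EuclideanSpace ℝ ι) : Prop :=
  ∀ (m : ℕ) (p : Fin m → EuclideanSpace ℝ ι) (c : Fin m → ℝ), (∀ a, 0 < inner ℝ (p a) n) →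
    0 ≤ ∑ a, ∑ b, c a * c b * K (p a - ((ℝ ∙ n)ᗮ).reflection (p b))

/-- Mirror invariance `K ∘ θ_n = K`, exactly the clause of the crux. -/
def IsMirrorInvariant {ι : Type} [Fintype ι] (K : EuclideanSpace ℝ ι → ℝ)
    (n : EuclideanSpace ℝ ι) : Prop :=
  ∀ x, K (((ℝ ∙ n)ᗮ).reflection x) = K x

/-- The nine lattice mirror normals of `ℤ³`: `eᵢ`, `eᵢ + eⱼ`, `eᵢ − eⱼ` (the crux's clause). -/
def IsLatticeMirror (n : E3) : Prop :=
  ∃ i j : Fin 3, i ≠ j ∧ (n = EuclideanSpace.single i 1 ∨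
    n = EuclideanSpace.single i 1 + EuclideanSpace.single j 1 ∨
    n = EuclideanSpace.single i 1 - EuclideanSpace.single j 1)

/-! ### The one analytic import (shared by all cards): one mirror, one complex variable -/

/-- POLARISED HALF-PLANE EXTENSION.  If `K` is even, `θ_n`-invariant, reflection positive for `n`
and bounded on every closed half-space `{⟪x,n⟫ ≥ t₀}`, `t₀ > 0`, then for every `x' ⊥ n` the two
functions `t ↦ K(t n) ± K(t n + x')` are quasibounded positive definite on the semigroup
`(]0,∞[,+)` (2×2 block polarisation of the Gram matrices of the configurations `{t_a n} ∪ {t_a n + x'}`),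
hence completely monotone (Berg–Christensen–Ressel 1984, Thm 8.1.4 / Example 8.1.5 — no continuity
needed); consequently `t ↦ K(t n + x')` is the restriction of a function holomorphic on the right
half-plane and bounded there by `K((Re t) n)`.  This is all the "Laplace–Fourier representation"
the line ever uses. -/
def PolarisedHalfPlaneExtension : Prop :=
  ∀ (K : E3 → ℝ) (n x' : E3), n ≠ 0 → inner ℝ x' n = 0 →
    (∀ x, K (-x) = K x) → IsMirrorInvariant K n → IsRP K n →
    (∀ t₀ : ℝ, 0 < t₀ → BddAbove ((fun x => |K x|) '' {x : E3 | t₀ ≤ inner ℝ x n})) →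
    ∃ g : ℂ → ℂ, DifferentiableOn ℂ g {z : ℂ | 0 < z.re} ∧
      (∀ t : ℝ, 0 < t → g t = (K (t • n + x') : ℂ)) ∧
      ∀ z : ℂ, 0 < z.re → ‖g z‖ ≤ K (z.re • n)

/-! ### Card `entire-profile-null-growth` — the planar engine -/

/-- The four line normals of the square lattice in the plane. -/
def IsSquareLatticeLine (ℓ : E2) : Prop :=
  ℓ = EuclideanSpace.single 0 1 ∨ ℓ = EuclideanSpace.single 1 1 ∨
    ℓ = EuclideanSpace.single 0 1 + EuclideanSpace.single 1 1 ∨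
    ℓ = EuclideanSpace.single 0 1 - EuclideanSpace.single 1 1

/-- PLANAR FOUR-LINE RIGIDITY (the `d = 2` theorem; claimed provable now from
`PolarisedHalfPlaneExtension` + one-variable complex analysis): a continuous, positive, even kernel on
`ℝ² ∖ 0`, homogeneous of degree `-β` with `0 < β < 4`, mirror-invariant and reflection positive in the
four lines `x₁ = 0`, `x₂ = 0`, `x₁ = ± x₂`, is radial.  Mechanism: the two OBLIQUE normals `e₂` and
`e₁+e₂` make the angular profile `κ` an entire `π/2`-periodic function with
`|κ(a+ib)| ≤ k(n̂)·(2 cosh b / sin 2a)^β` on each normal's strips, so `sup_a |κ(a+ib)| ≤ C e^{β|b|}`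
and every Fourier mode `e^{4imω}`, `m ≠ 0`, dies because `4|m| > β`. -/
def PlanarFourLineRigidity : Prop :=
  ∀ (β : ℝ) (k : E2 → ℝ), 0 < β → β < 4 → ContinuousOn k {0}ᶜ → (∀ y, y ≠ 0 → 0 < k y) →
    (∀ y, k (-y) = k y) → (∀ c : ℝ, 0 < c → ∀ y, k (c • y) = c ^ (-β) * k y) →
    (∀ ℓ : E2, IsSquareLatticeLine ℓ → IsMirrorInvariant k ℓ ∧ IsRP k ℓ) →
    ∀ (R : E2 ≃ₗᵢ[ℝ] E2) (y : E2), k (R y) = k y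

/-- COORDINATE-PLANE ISOTROPY (first rung of the seven-circle web, same mechanism in `d = 3`): a
nine-mirror-RP homogeneous kernel of degree `-β`, `0 < β < 4`, is radial on the plane `x₃ = 0`
(likewise on the other coordinate planes and, with `6|m| > β`, on the four planes `x ± y ± z = 0`). -/
def CoordinatePlaneIsotropy : Prop :=
  ∀ (β : ℝ) (K : E3 → ℝ), 0 < β → β < 4 → ContinuousOn K {0}ᶜ → (∀ x, x ≠ 0 → 0 < K x) →
    (∀ x, K (-x) = K x) → (∀ c : ℝ, 0 < c → ∀ x, K (c • x) = c ^ (-β) * K x) →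
    (∀ n : E3, IsLatticeMirror n → IsMirrorInvariant K n ∧ IsRP K n) →
    ∀ (R : E3 ≃ₗᵢ[ℝ] E3), R (EuclideanSpace.single 2 1) = EuclideanSpace.single 2 1 →
      ∀ x : E3, x 2 = 0 → K (R x) = K x

/-- The envelope statement `(E₉)` of the gen-1 card (kept as the card's recorded Transfer; the lead
card `riesz-probe-xray-mellin` now bypasses it): on EVERY great circle through a lattice normal the
angular profile is entire of exponential type `≤ β`. -/
def NineSlabEntireProfiles : Prop :=
  ∀ (β : ℝ) (K : E3 → ℝ), 0 < β → β < 4 → ContinuousOn K {0}ᶜ → (∀ x, x ≠ 0 → 0 < K x) →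
    (∀ x, K (-x) = K x) → (∀ c : ℝ, 0 < c → ∀ x, K (c • x) = c ^ (-β) * K x) →
    (∀ n : E3, IsLatticeMirror n → IsMirrorInvariant K n ∧ IsRP K n) →
    ∀ (n u : E3), IsLatticeMirror n → inner ℝ u n = 0 → ‖u‖ = 1 →
      ∃ g : ℂ → ℂ, Differentiable ℂ g ∧
        (∀ ω : ℝ, g ω = (K (Real.cos ω • u + Real.sin ω • (‖n‖⁻¹ • n)) : ℂ)) ∧
        ∃ C : ℝ, ∀ ω : ℂ, ‖g ω‖ ≤ C * Real.exp (β * |ω.im|)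

/-! ### Card `riesz-probe-xray-mellin` — the reduction `d = 3 ⇒ d = 2` and the closing -/

/-- The Riesz probe: Schur (entrywise) product with `‖x‖^{-γ}`, `γ ≥ 1` (a kernel that is invariant
and reflection positive for EVERY plane through the origin in `ℝ³`: `Δ = γ/2 ≥ 1/2`, the unitarity
bound; Stieltjes sections `(s+q²)^{-(3-γ)/2}` for `1 ≤ γ < 3`, Yukawa mixtures / products beyond),
preserves mirror invariance and — by the Schur product theorem for the Gram matrices — reflection
positivity. -/
def SchurRieszProbe : Prop :=
  ∀ (K : E3 → ℝ) (γ : ℝ) (n : E3), 1 ≤ γ → n ≠ 0 →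
    IsMirrorInvariant K n → IsRP K n →
    IsMirrorInvariant (fun x => K x * ‖x‖ ^ (-γ)) n ∧ IsRP (fun x => K x * ‖x‖ ^ (-γ)) n

/-- Embedding of a planar point `y` at height `s` along the `x₃`-axis. -/
noncomputable def lift (y : E2) (s : ℝ) : E3 :=
  (WithLp.equiv 2 (Fin 3 → ℝ)).symm ![y 0, y 1, s]

/-- The axial X-ray (marginal along `e₃`) of a kernel on `ℝ³`. -/
noncomputable def axialMarginal (K : E3 → ℝ) (y : E2) : ℝ :=
  ∫ s : ℝ, K (lift y s)

/-- X-RAY OF THE PROBED KERNEL IS A PLANAR FOUR-LINE-RP KERNEL.  For a nine-mirror-RP homogeneous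
kernel `K` of degree `-β` (`β > 0`) and a probe exponent `γ ≥ 1`, the marginal
`M_γ(y) = ∫ K(y,s)·(‖y‖²+s²)^{-γ/2} ds` along the `x₃`-axis is continuous, positive, even,
homogeneous of degree `-(β+γ-1)` and invariant + reflection positive in the four lines of the square
lattice (the traces of the four lattice mirrors containing the `x₃`-axis: Fejér-weighted Riemann sums
of 3D Gram matrices over the grids `y_a + jh·e₃`, which the four mirrors do not move vertically). -/
def XRayFourLineRP : Prop :=
  ∀ (β γ : ℝ) (K : E3 → ℝ), 0 < β → 1 ≤ γ → ContinuousOn K {0}ᶜ → (∀ x, x ≠ 0 → 0 < K x) →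
    (∀ c : ℝ, 0 < c → ∀ x, K (c • x) = c ^ (-β) * K x) →
    (∀ n : E3, IsLatticeMirror n → IsMirrorInvariant K n ∧ IsRP K n) →
    ContinuousOn (axialMarginal (fun x => K x * ‖x‖ ^ (-γ))) {0}ᶜ ∧
    (∀ y, y ≠ 0 → 0 < axialMarginal (fun x => K x * ‖x‖ ^ (-γ)) y) ∧
    (∀ y, axialMarginal (fun x => K x * ‖x‖ ^ (-γ)) (-y) =
      axialMarginal (fun x => K x * ‖x‖ ^ (-γ)) y) ∧
    (∀ c : ℝ, 0 < c → ∀ y, axialMarginal (fun x => K x * ‖x‖ ^ (-γ)) (c • y) =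
      c ^ (-(β + γ - 1)) * axialMarginal (fun x => K x * ‖x‖ ^ (-γ)) y) ∧
    (∀ ℓ : E2, IsSquareLatticeLine ℓ →
      IsMirrorInvariant (axialMarginal (fun x => K x * ‖x‖ ^ (-γ))) ℓ ∧
      IsRP (axialMarginal (fun x => K x * ‖x‖ ^ (-γ))) ℓ)

/-- MELLIN STEP: if the probed X-rays are radial for every probe exponent in the interval
`[1, 5 - β)` (non-empty iff `β < 4`), then `K` is invariant under the rotations about the `x₃`-axis.
(On the unit circle `M_γ(ŷ) = ∫ K(ŷ + s e₃)(1+s²)^{-γ/2} ds` is a Laplace transform in `γ/2` of the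
push-forward of `K(ŷ + s e₃) ds` under `s ↦ log(1+s²)`; agreement on an interval of `γ` ⇒ agreement
of the finite positive measures ⇒ `K(ŷ + s e₃)` independent of `ŷ`, by evenness in `s` (mirror `e₃`)
and continuity; homogeneity does the rest.) -/
def RadialXRaysGiveAxialSymmetry : Prop :=
  ∀ (β : ℝ) (K : E3 → ℝ), 0 < β → β < 4 → ContinuousOn K {0}ᶜ → (∀ x, x ≠ 0 → 0 < K x) →
    (∀ c : ℝ, 0 < c → ∀ x, K (c • x) = c ^ (-β) * K x) →
    IsMirrorInvariant K (EuclideanSpace.single 2 1) →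
    (∀ γ : ℝ, 1 ≤ γ → γ < 5 - β → ∀ (R : E2 ≃ₗᵢ[ℝ] E2) (y : E2),
      axialMarginal (fun x => K x * ‖x‖ ^ (-γ)) (R y) =
        axialMarginal (fun x => K x * ‖x‖ ^ (-γ)) y) →
    ∀ (R : E2 ≃ₗᵢ[ℝ] E2) (y : E2) (s : ℝ), K (lift (R y) s) = K (lift y s)

/-- THE PACKAGED TARGET of the lead card (= window-free nine-mirror rigidity below degree four; it is
item 1979 `HRP2Rigidity` with its window `1 ≤ 2Δ ≤ 2` widened to `0 < 2Δ < 4`, and it implies the crux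
with `β = 3 - α ∈ (1,2]`, see the checked reduction below): a continuous positive kernel on `ℝ³ ∖ 0`,
homogeneous of degree `-β` with `0 < β < 4`, invariant and reflection positive for the nine lattice
mirrors, is invariant under every linear isometry.  Chain: `SchurRieszProbe` → `XRayFourLineRP` →
`PlanarFourLineRigidity` (degree `β+γ-1 < 4`) → `RadialXRaysGiveAxialSymmetry` for the axes `e₃` and
`e₁` → rotations about two axes generate `SO(3)`, and `-1 = θ₁θ₂θ₃`. -/
def NineMirrorRigidityBelowFour : Prop :=
  ∀ (β : ℝ) (K : E3 → ℝ), 0 < β → β < 4 → ContinuousOn K {0}ᶜ → (∀ x, x ≠ 0 → 0 < K x) →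
    (∀ c : ℝ, 0 < c → ∀ x, K (c • x) = c ^ (-β) * K x) →
    (∀ n : E3, IsLatticeMirror n → IsMirrorInvariant K n ∧ IsRP K n) →
    ∀ (R : E3 ≃ₗᵢ[ℝ] E3) (x : E3), K (R x) = K x

/-- CHECKED TRANSFER: the packaged target implies the crux verbatim (the stable-cone data `Φ` and the
potential equation are simply not needed; `β := 3 - α ∈ (1, 2] ⊂ (0, 4)`). -/
theorem stableConeRPRigidity_of_nineMirrorRigidityBelowFour (h : NineMirrorRigidityBelowFour) :
    Summit.CriticalPhenomena.Ising3DConformalLimit.Theses.PrecisionLaplacian.StableConeRPRigidity := by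
  intro α Φ K hα1 hα2 _hΦc _hΦnn _hΦpos _hΦeven hKc hKpos hKhom _hPot hMirror R x
  refine h (3 - α) K (by linarith) (by linarith) hKc hKpos ?_ ?_ R x
  · intro c hc y
    have := hKhom c hc y
    have e : (-(3 - α) : ℝ) = α - 3 := by ring
    rw [e]; exact this
  · intro n hn
    exact hMirror n hn


/-- CHECKED TRANSFER (bonus): the same packaged target implies item 1979 `HRP2Rigidity` of route
`HyperoctahedralRP` verbatim (`β := 2Δ ∈ [1, 2] ⊂ (0, 4)`). -/
theorem hrp2Rigidity_of_nineMirrorRigidityBelowFour (h : NineMirrorRigidityBelowFour) :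
    Summit.CriticalPhenomena.Ising3DConformalLimit.Theses.HyperoctahedralRP.HRP2Rigidity := by
  intro Δ K hΔ1 hΔ2 hKc hKpos hKhom hMirror R x
  exact h (2 * Δ) K (by linarith) (by linarith) hKc hKpos hKhom (fun n hn => hMirror n hn) R x

/-! ### Card `levy-side-linearisation` — descent of RP to the Lévy kernel -/

/-- The Lévy-side kernel of the stable cone: `J_Φ(z) = ‖z‖^{-(3+α)} Φ(z/‖z‖)`. -/
noncomputable def levyKernel (α : ℝ) (Φ : E3 → ℝ) (z : E3) : ℝ :=
  ‖z‖ ^ (-(3 + α)) * Φ (‖z‖⁻¹ • z)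

/-- FIRST LEMMA of card `levy-side-linearisation`: RP DESCENDS FROM THE POTENTIAL KERNEL TO THE LÉVY
KERNEL.  Hypotheses on `(α, Φ, K)` verbatim from the crux, for ONE mirror normal `n ≠ 0`: if `K` is
`θ_n`-invariant and reflection positive, so is `J_Φ` (sections `s ↦ ψ_Φ(√s n + q)` are complete
Bernstein with no linear term; Lévy–Khintchine read along `n`; Bernstein + Bochner). -/
def RPDescendsToLevyMeasure : Prop :=
  ∀ (α : ℝ) (Φ K : E3 → ℝ) (n : E3), 1 ≤ α → α < 2 → n ≠ 0 →
    ContinuousOn Φ (Metric.sphere 0 1) → (∀ u ∈ Metric.sphere (0 : E3) 1, 0 ≤ Φ u) →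
    (∀ u, Φ (-u) = Φ u) → ContinuousOn K {0}ᶜ → (∀ x, x ≠ 0 → 0 < K x) →
    (∀ c : ℝ, 0 < c → ∀ x, K (c • x) = c ^ (α - 3) * K x) →
    (∀ f : E3 → ℝ, ContDiff ℝ 2 f → HasCompactSupport f → ∀ x,
      (∫ y, K (x - y) * ((1/2 : ℝ) * ∫ z, (f (y + z) + f (y - z) - 2 * f y) *
        (‖z‖ ^ (-(3 + α)) * Φ (‖z‖⁻¹ • z)))) = - f x) →
    IsMirrorInvariant K n → IsRP K n →
    IsRP (levyKernel α Φ) n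

end Summit.CriticalPhenomena.Ising3DConformalLimit.Cruxes.StableConeRPRigidity.Sketch
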